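import Summits.QuantumFields.YangMills.Theses.ParabolicTrajectory
import Literature.MathematicalPhysics.QuantumLattice.LatticeGaugeDLRBoxKernels
import Literature.MathematicalPhysics.QuantumFieldTheory.LatticeGaugeProofs
import Literature.Probability.Moments.CovarianceFreezing

/-!
# Stub `stub_dlrDecoupling` of the line `dirichlet-box-localisation`
# (crux `ParabolicTrajectory.TunedSequenceExists`, item stmt-QuantumFields-10524)

**DLR decoupling, two separated boxes.** On the torus of side `2L+1` let `P = tr F²` be the
action density at the origin, `P_m = P ∘ τ_{m e₀}`, `Λ₁ = Λ(R, 0)`, `Λ₂ = Λ(R, m e₀)`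
(`Λ(R, c) = ((box 4 R).image (· + c)) ×ˢ univ`), `1 ≤ R`, `2R + 3 ≤ m`, `m + R + 1 ≤ L`, and
`h₁ = γ_{Λ₁} P`, `h₂ = γ_{Λ₂} P_m` (`γ = ymSpecification r.ρ β`). Four DLR steps on the torus
(`integral_torusLift_eq_integral_ymSpecification`) and properness of the kernels (the support of
`P_m` misses `Λ₁`; the support of `h₁` = `supp P` plus the collar of `Λ₁` misses `Λ₂`) give
`⟨P ; P_m⟩_{torus} = Cov(h₁ ∘ lift, h₂ ∘ lift)`; the abstract bound
`Literature.Probability.Moments.abs_cov_le_osc` (freeze the bad boundary data, then Popoviciu +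
Cauchy–Schwarz; `|P| ≤ 6N`) yields `|⟨P ; P_m⟩| ≤ ab/4 + 8(6N)²p ≤ ab/4 + 16(6N)²p`. No reflection
positivity is used (odd torus). Main results: `abs_corr_le` (geometric form, general bounded
continuous cylinder observable) and the registered signature `stub_dlrDecoupling`.
-/

noncomputable section

open Filter Topology MeasureTheory
open Literature.MathematicalPhysics.QuantumFieldTheory hiding ZdEdge
open Literature.MathematicalPhysics.QuantumLattice
open Literature.Probability.LatticeModels (box mem_box)
open Literature.Probability.Moments (abs_cov_le_osc)

namespace Summit.QuantumFields.YangMills.Theorems.TunedSequenceExists.DirichletBoxLocalisation.Decoupling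

section Curvature

variable {G : Type} [Group G] [TopologicalSpace G] [IsTopologicalGroup G] [CompactSpace G]
  [MeasurableSpace G] [BorelSpace G]

/-- Edges in the support of the curvature species have all coordinates in `{0, 1}`. -/
theorem coord_of_mem_curvature_supp (r : LatticeRep G) {e : ZdEdge 4} (he : e ∈ r.curvature.supp)
    (k : Fin 4) : 0 ≤ e.1 k ∧ e.1 k ≤ 1 := by
  have hsupp : r.curvature.supp =
      Finset.univ.biUnion fun p : Fin 4 × Fin 4 => originPlaquetteSupport p.1 p.2 := rfl
  rw [hsupp, Finset.mem_biUnion] at he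
  obtain ⟨p, -, hp⟩ := he
  simp only [originPlaquetteSupport, Finset.mem_insert, Finset.mem_singleton] at hp
  rcases hp with rfl | rfl | rfl | rfl
  · simp
  · simp only [Pi.single_apply]; split_ifs <;> simp
  · simp only [Pi.single_apply]; split_ifs <;> simp
  · simp

/-- The support of the translate `P ∘ τ_{m e₀}`: coordinates in `[0, m + 1]`, time `≥ m`. -/
theorem coord_of_mem_curvature_supp_shift (r : LatticeRep G) (m : ℕ) {e : ZdEdge 4}
    (he : e ∈ r.curvature.supp.image fun e => (e.1 - -Pi.single 0 (m : ℤ), e.2)) :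
    (m : ℤ) ≤ e.1 0 ∧ ∀ k, 0 ≤ e.1 k ∧ e.1 k ≤ m + 1 := by
  obtain ⟨e₀, he₀, rfl⟩ := Finset.mem_image.1 he
  have h := coord_of_mem_curvature_supp r he₀
  simp only [sub_neg_eq_add, Pi.add_apply, Pi.single_apply]
  refine ⟨by simp only [↓reduceIte]; linarith [(h 0).1], fun k => ?_⟩
  have hk := h k
  split_ifs <;> omega

/-- The support of `P ∘ τ_{m e₀}` misses the box `Λ(R, 0)` when `R < m`. -/
theorem curvature_supp_shift_not_mem (r : LatticeRep G) {R m : ℕ} (hRm : R < m) :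
    ∀ e ∈ r.curvature.supp.image (fun e => (e.1 - -Pi.single 0 (m : ℤ), e.2)),
      e ∉ ((box 4 R).image (· + (0 : Fin 4 → ℤ))) ×ˢ (Finset.univ : Finset (Fin 4)) :=
  fun e he heΛ => by
  have h1 := (coord_of_mem_curvature_supp_shift r m he).1
  have h2 := (coord_of_mem_boxEdges heΛ 0).2
  simp only [Pi.zero_apply] at h2
  omega

/-- `supp P` and the collar of `Λ(R, 0)` miss the box `Λ(R, m e₀)` when `2R + 3 ≤ m`. -/
theorem supp_union_collar_not_mem (r : LatticeRep G) {R m : ℕ} (hRm : 2 * R + 3 ≤ m) :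
    ∀ e ∈ r.curvature.supp ∪
        (plaquettesTouching (((box 4 R).image (· + (0 : Fin 4 → ℤ))) ×ˢ
          (Finset.univ : Finset (Fin 4)))).biUnion plaquetteEdges,
      e ∉ ((box 4 R).image (· + (Pi.single 0 (m : ℤ) : Fin 4 → ℤ))) ×ˢ
        (Finset.univ : Finset (Fin 4)) := fun e he heΛ => by
  have h2 := (coord_of_mem_boxEdges heΛ 0).1
  simp only [Pi.single_eq_same] at h2
  rcases Finset.mem_union.1 he with he | he
  · have := (coord_of_mem_curvature_supp r he 0).2
    omega
  · obtain ⟨e', he', hn⟩ := exists_near_of_mem_collar he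
    have h3 := (coord_of_mem_boxEdges he' 0).2
    simp only [Pi.zero_apply] at h3
    have := (hn 0).2
    omega

/-- `|P| ≤ 6N`: six planes, each plaquette observable bounded by `N` (unitarity). -/
theorem abs_curvature_le (r : LatticeRep G) (U : LGConfig 4 G) :
    |r.curvature.F U| ≤ 6 * (r.N : ℝ) := by
  show |actionDensity r.ρ U| ≤ 6 * (r.N : ℝ)
  unfold actionDensity
  have hb : ∀ i j : Fin 4, |(if i < j then plaquetteObs r.ρ 0 i j U else 0)| ≤
      if i < j then (r.N : ℝ) else 0 := by
    intro i j
    split_ifs with h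
    · exact abs_plaquetteObs_le_holds r.ρ r.mem_unitary 0 i j U
    · simp
  calc |∑ i : Fin 4, ∑ j : Fin 4, (if i < j then plaquetteObs r.ρ 0 i j U else 0)|
      ≤ ∑ i : Fin 4, ∑ j : Fin 4, (if i < j then (r.N : ℝ) else 0) :=
        (Finset.abs_sum_le_sum_abs _ _).trans (Finset.sum_le_sum fun i _ =>
          (Finset.abs_sum_le_sum_abs _ _).trans (Finset.sum_le_sum fun j _ => hb i j))
    _ = 6 * (r.N : ℝ) := by
        simp only [Fin.sum_univ_four, Fin.isValue]
        norm_num [Fin.lt_def]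
        ring

end Curvature

section Technical

variable {G : Type} [Group G] [TopologicalSpace G] [IsTopologicalGroup G] [CompactSpace G]
  [MeasurableSpace G] [BorelSpace G] [SecondCountableTopology G] {N : ℕ}

/-- **DLR decoupling in geometric form.** `P` a continuous cylinder observable, `|P| ≤ K`,
support `supp`; `Λ₁`, `Λ₂` edge sets with: `Λᵢ` plus collar, `supp`, `supp + m e₀` based in
`box 4 L`; `supp + m e₀` misses `Λ₁`; `supp` and the collar of `Λ₁` miss `Λ₂`. If `γ_{Λ₁} P`,
`γ_{Λ₂} P_m` oscillate by `≤ a`, `≤ b` off bad sets charged `≤ p` by the torus Wilson state of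
side `2L+1`, then `|⟨P ; P_m⟩_{torus}| ≤ ab/4 + 8K²p`. -/
theorem abs_corr_le (ρ : G →* Matrix (Fin N) (Fin N) ℂ) (hρ : Continuous ρ) (β : ℝ) {L m : ℕ}
    {P : LGConfig 4 G → ℝ} (hPc : Continuous P) (hPm : Measurable P) {K : ℝ} (hK : 0 ≤ K)
    (hPK : ∀ U, |P U| ≤ K) {supp Λ₁ Λ₂ : Finset (ZdEdge 4)} (hPs : IsCylinder P supp)
    (hΛ₁ : ∀ e ∈ Λ₁ ∪ (plaquettesTouching Λ₁).biUnion plaquetteEdges, e.1 ∈ box 4 L)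
    (hΛ₂ : ∀ e ∈ Λ₂ ∪ (plaquettesTouching Λ₂).biUnion plaquetteEdges, e.1 ∈ box 4 L)
    (hs : ∀ e ∈ supp, e.1 ∈ box 4 L)
    (hs' : ∀ e ∈ supp.image (fun e => (e.1 - -Pi.single 0 (m : ℤ), e.2)), e.1 ∈ box 4 L)
    (hd₁ : ∀ e ∈ supp.image (fun e => (e.1 - -Pi.single 0 (m : ℤ), e.2)), e ∉ Λ₁)
    (hd₂ : ∀ e ∈ supp ∪ (plaquettesTouching Λ₁).biUnion plaquetteEdges, e ∉ Λ₂)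
    {a b p : ℝ} (ha : 0 ≤ a) (hb : 0 ≤ b) (hp : 0 ≤ p) {Bad₁ Bad₂ : Set (LGConfig 4 G)}
    (hBad₁ : MeasurableSet Bad₁) (hBad₂ : MeasurableSet Bad₂)
    (hosc₁ : ∀ η η' : LGConfig 4 G, η ∉ Bad₁ → η' ∉ Bad₁ →
      |(∫ U, P U ∂(ymSpecification ρ β Λ₁ η)) - ∫ U, P U ∂(ymSpecification ρ β Λ₁ η')| ≤ a)
    (hosc₂ : ∀ η η' : LGConfig 4 G, η ∉ Bad₂ → η' ∉ Bad₂ →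
      |(∫ U, P (configShift (-Pi.single 0 (m : ℤ)) U) ∂(ymSpecification ρ β Λ₂ η)) -
          ∫ U, P (configShift (-Pi.single 0 (m : ℤ)) U) ∂(ymSpecification ρ β Λ₂ η')| ≤ b)
    (hμ₁ : (wilsonMeasure (d := 4) (L := 2 * L + 1) ρ β) {U | torusLift (2 * L + 1) U ∈ Bad₁} ≤
      ENNReal.ofReal p)
    (hμ₂ : (wilsonMeasure (d := 4) (L := 2 * L + 1) ρ β) {U | torusLift (2 * L + 1) U ∈ Bad₂} ≤
      ENNReal.ofReal p) :
    |latticeConnectedCorr ρ β (2 * L + 1) P P m| ≤ a * b / 4 + 8 * K ^ 2 * p := by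
  haveI : IsProbabilityMeasure (wilsonMeasure (d := 4) (L := 2 * L + 1) ρ β) :=
    isProbabilityMeasure_wilsonMeasure ρ hρ β
  -- the translated observable `P_m`
  have hPmc : Continuous fun U : LGConfig 4 G => P (configShift (-Pi.single 0 (m : ℤ)) U) :=
    hPc.comp (continuous_configShift _)
  have hPmm : Measurable fun U : LGConfig 4 G => P (configShift (-Pi.single 0 (m : ℤ)) U) :=
    hPm.comp (configShift _).measurable
  have hPmK : ∀ U : LGConfig 4 G, |P (configShift (-Pi.single 0 (m : ℤ)) U)| ≤ K := fun U => hPK _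
  have hPms : IsCylinder (fun U : LGConfig 4 G => P (configShift (-Pi.single 0 (m : ℤ)) U))
      (supp.image fun e => (e.1 - -Pi.single 0 (m : ℤ), e.2)) :=
    IsCylinder.comp_configShift hPs _
  -- the one-box conditional expectations `h₁`, `h₂`
  have h₁c : Continuous fun η => ∫ U, P U ∂(ymSpecification ρ β Λ₁ η) :=
    continuous_integral_ymSpecification ρ hρ β Λ₁ hPc hPK
  have h₁K : ∀ η, |∫ U, P U ∂(ymSpecification ρ β Λ₁ η)| ≤ K :=
    abs_integral_ymSpecification_le ρ hρ β Λ₁ hPK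
  have h₁s : IsCylinder (fun η => ∫ U, P U ∂(ymSpecification ρ β Λ₁ η))
      (supp ∪ (plaquettesTouching Λ₁).biUnion plaquetteEdges) :=
    dependsOn_integral_ymSpecification ρ hρ β Λ₁ hPm hPs
  have h₂c : Continuous fun η =>
      ∫ U, P (configShift (-Pi.single 0 (m : ℤ)) U) ∂(ymSpecification ρ β Λ₂ η) :=
    continuous_integral_ymSpecification ρ hρ β Λ₂ hPmc hPmK
  have h₂K : ∀ η, |∫ U, P (configShift (-Pi.single 0 (m : ℤ)) U) ∂(ymSpecification ρ β Λ₂ η)| ≤ K :=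
    abs_integral_ymSpecification_le ρ hρ β Λ₂ hPmK
  have hKK : ∀ {f g : LGConfig 4 G → ℝ}, (∀ U, |f U| ≤ K) → (∀ U, |g U| ≤ K) →
      ∀ U, |f U * g U| ≤ K * K := fun hf hg U => by
    rw [abs_mul]; exact mul_le_mul (hf U) (hg U) (abs_nonneg _) hK
  -- the four DLR identities
  have E2 := integral_torusLift_eq_integral_ymSpecification ρ hρ β Λ₁ hPc hPK hPs hΛ₁ hs
  have E3 := integral_torusLift_eq_integral_ymSpecification ρ hρ β Λ₂ hPmc hPmK hPms hΛ₂ hs'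
  have Ea := integral_torusLift_eq_integral_ymSpecification ρ hρ β Λ₁
    (F := fun U => P U * P (configShift (-Pi.single 0 (m : ℤ)) U)) (hPc.mul hPmc) (hKK hPK hPmK)
    (IsCylinder.mul hPs hPms) hΛ₁ (Finset.forall_mem_union.2 ⟨hs, hs'⟩)
  have Eb := integral_torusLift_eq_integral_ymSpecification ρ hρ β Λ₂
    (F := fun η => (∫ U, P U ∂(ymSpecification ρ β Λ₁ η)) *
      P (configShift (-Pi.single 0 (m : ℤ)) η)) (h₁c.mul hPmc) (hKK h₁K hPmK)
    (IsCylinder.mul h₁s hPms) hΛ₂ (Finset.forall_mem_union.2 ⟨Finset.forall_mem_union.2 ⟨hs,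
      fun e he => hΛ₁ e (Finset.mem_union_right _ he)⟩, hs'⟩)
  -- factor-out under the kernels
  have Ea' : ∀ η, ∫ W, P W * P (configShift (-Pi.single 0 (m : ℤ)) W) ∂(ymSpecification ρ β Λ₁ η) =
      (∫ W, P W ∂(ymSpecification ρ β Λ₁ η)) * P (configShift (-Pi.single 0 (m : ℤ)) η) :=
    fun η => integral_ymSpecification_mul_cyl ρ hρ β Λ₁ hPm hPmm hPms hd₁ η
  have Eb' : ∀ η, ∫ W, (∫ W', P W' ∂(ymSpecification ρ β Λ₁ W)) *
      P (configShift (-Pi.single 0 (m : ℤ)) W) ∂(ymSpecification ρ β Λ₂ η) =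
      (∫ W', P W' ∂(ymSpecification ρ β Λ₁ η)) *
        ∫ W, P (configShift (-Pi.single 0 (m : ℤ)) W) ∂(ymSpecification ρ β Λ₂ η) :=
    fun η => integral_ymSpecification_cyl_mul ρ hρ β Λ₂ hPmm h₁c.measurable h₁s hd₂ η
  have E1 : ∫ U, P (torusLift (2 * L + 1) U) *
      P (configShift (-Pi.single 0 (m : ℤ)) (torusLift (2 * L + 1) U))
        ∂(wilsonMeasure (d := 4) (L := 2 * L + 1) ρ β) =
      ∫ U, (∫ W', P W' ∂(ymSpecification ρ β Λ₁ (torusLift (2 * L + 1) U))) *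
        ∫ W, P (configShift (-Pi.single 0 (m : ℤ)) W)
          ∂(ymSpecification ρ β Λ₂ (torusLift (2 * L + 1) U))
        ∂(wilsonMeasure (d := 4) (L := 2 * L + 1) ρ β) := by
    rw [Ea]
    refine (integral_congr_ae (ae_of_all _ fun U => Ea' _)).trans ?_
    rw [Eb]
    exact integral_congr_ae (ae_of_all _ fun U => Eb' _)
  -- translation invariance of the torus state
  have hshift : ∫ U, P (configShift (-Pi.single 0 (m : ℤ)) (torusLift (2 * L + 1) U))
      ∂(wilsonMeasure (d := 4) (L := 2 * L + 1) ρ β) =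
      ∫ U, P (torusLift (2 * L + 1) U) ∂(wilsonMeasure (d := 4) (L := 2 * L + 1) ρ β) := by
    have h := wilsonExpectation_comp_torusConfigShift (d := 4) (L := 2 * L + 1) ρ β
      (Literature.Probability.LatticeModels.Torus.proj (2 * L + 1) (-Pi.single 0 (m : ℤ)))
      (toTorusObservable (2 * L + 1) P)
    rw [← toTorusObservable_comp_configShift] at h
    simpa [wilsonExpectation, toTorusObservable] using h
  -- `⟨P ; P_m⟩ = Cov(h₁ ∘ lift, h₂ ∘ lift)`
  have key : latticeConnectedCorr ρ β (2 * L + 1) P P m =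
      (∫ U, (∫ W', P W' ∂(ymSpecification ρ β Λ₁ (torusLift (2 * L + 1) U))) *
        ∫ W, P (configShift (-Pi.single 0 (m : ℤ)) W)
          ∂(ymSpecification ρ β Λ₂ (torusLift (2 * L + 1) U))
        ∂(wilsonMeasure (d := 4) (L := 2 * L + 1) ρ β)) -
      (∫ U, (∫ W', P W' ∂(ymSpecification ρ β Λ₁ (torusLift (2 * L + 1) U)))
        ∂(wilsonMeasure (d := 4) (L := 2 * L + 1) ρ β)) *
      ∫ U, (∫ W, P (configShift (-Pi.single 0 (m : ℤ)) W)
          ∂(ymSpecification ρ β Λ₂ (torusLift (2 * L + 1) U)))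
        ∂(wilsonMeasure (d := 4) (L := 2 * L + 1) ρ β) := by
    unfold latticeConnectedCorr
    rw [E1, ← E3, hshift, ← E2]
  rw [key]
  refine abs_cov_le_osc (h₁c.measurable.comp (measurable_torusLift _))
    (h₂c.measurable.comp (measurable_torusLift _)) hK ha hb (fun U => h₁K _) (fun U => h₂K _)
    (measurable_torusLift _ hBad₁) (measurable_torusLift _ hBad₂)
    (ENNReal.toReal_le_of_le_ofReal hp hμ₁) (ENNReal.toReal_le_of_le_ofReal hp hμ₂)
    (fun U U' hU hU' => hosc₁ _ _ hU hU') (fun U U' hU hU' => hosc₂ _ _ hU hU')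

end Technical

/-- **STUB `stub_dlrDecoupling` · DLR decoupling, two separated boxes** (line
`dirichlet-box-localisation`, crux `ParabolicTrajectory.TunedSequenceExists`; the registered
`DirichletBoxLocalisation.DLRDecouplingAll` verbatim): for every compact `G`, lattice representation
`r`, `β`, `R ≥ 1`, `m ≥ 2R + 3`, torus `2L + 1` with `m + R + 1 ≤ L`, one-box oscillations `≤ a`,
`≤ b` off measurable `Bad₁`, `Bad₂` charged `≤ p`: `|⟨P ; P_m⟩_{β, 2L+1}| ≤ ab/4 + 16·(6N)²·p`
(`abs_corr_le` with `K = 6N`). -/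
theorem stub_dlrDecoupling :
    ∀ (G : Type) [Group G] [TopologicalSpace G] [IsTopologicalGroup G] [CompactSpace G],
      letI : MeasurableSpace G := borel G
      haveI : BorelSpace G := ⟨rfl⟩
      ∀ (r : LatticeRep G),
    ∀ (β a b p : ℝ) (R L m : ℕ) (Bad₁ Bad₂ : Set (LGConfig 4 G)),
        MeasurableSet Bad₁ → MeasurableSet Bad₂ → 1 ≤ R → 2 * R + 3 ≤ m → m + R + 1 ≤ L →
        0 ≤ a → 0 ≤ b → 0 ≤ p →
        (∀ η η' : LGConfig 4 G, η ∉ Bad₁ → η' ∉ Bad₁ →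
          |(∫ U, r.curvature.F U
                ∂(ymSpecification r.ρ β (((box 4 R).image (· + (0 : Fin 4 → ℤ))) ×ˢ Finset.univ) η)) -
              ∫ U, r.curvature.F U
                ∂(ymSpecification r.ρ β (((box 4 R).image (· + (0 : Fin 4 → ℤ))) ×ˢ Finset.univ) η')| ≤
            a) →
        (∀ η η' : LGConfig 4 G, η ∉ Bad₂ → η' ∉ Bad₂ →
          |(∫ U, r.curvature.F (configShift (-Pi.single 0 (m : ℤ)) U)
                ∂(ymSpecification r.ρ β
                  (((box 4 R).image (· + (Pi.single 0 (m : ℤ) : Fin 4 → ℤ))) ×ˢ Finset.univ) η)) -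
              ∫ U, r.curvature.F (configShift (-Pi.single 0 (m : ℤ)) U)
                ∂(ymSpecification r.ρ β
                  (((box 4 R).image (· + (Pi.single 0 (m : ℤ) : Fin 4 → ℤ))) ×ˢ Finset.univ) η')| ≤
            b) →
        (wilsonMeasure (d := 4) (L := 2 * L + 1) r.ρ β) {U | torusLift (2 * L + 1) U ∈ Bad₁} ≤
            ENNReal.ofReal p →
        (wilsonMeasure (d := 4) (L := 2 * L + 1) r.ρ β) {U | torusLift (2 * L + 1) U ∈ Bad₂} ≤
            ENNReal.ofReal p →
        |latticeConnectedCorr r.ρ β (2 * L + 1) r.curvature.F r.curvature.F m| ≤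
          a * b / 4 + 16 * (6 * (r.N : ℝ)) ^ 2 * p := by
  intro G _ _ _ _
  letI : MeasurableSpace G := borel G
  haveI : BorelSpace G := ⟨rfl⟩
  intro r β a b p R L m Bad₁ Bad₂ hBad₁ hBad₂ hR hRm hmL ha hb hp hosc₁ hosc₂ hμ₁ hμ₂
  haveI : SecondCountableTopology G :=
    (r.continuous.isClosedEmbedding r.injective).isEmbedding.secondCountableTopology
  have hK : (0 : ℝ) ≤ 6 * (r.N : ℝ) := by positivity
  have hc₁ : ∀ k : Fin 4, |(0 : Fin 4 → ℤ) k| + R + 1 ≤ L := fun k => by simp; omega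
  have hc₂ : ∀ k : Fin 4, |(Pi.single 0 (m : ℤ) : Fin 4 → ℤ) k| + R + 1 ≤ L := fun k => by
    rw [Pi.single_apply]
    split_ifs <;> simp <;> omega
  have h := abs_corr_le r.ρ r.continuous β (P := r.curvature.F)
    (continuous_actionDensity r.continuous) r.curvature.measurable hK (abs_curvature_le r)
    r.curvature.isCylinder (fun e he => fst_mem_box_of_mem_boxEdges_union hc₁ he)
    (fun e he => fst_mem_box_of_mem_boxEdges_union hc₂ he)
    (fun e he => mem_box.2 fun k => by have := coord_of_mem_curvature_supp r he k; omega)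
    (fun e he => mem_box.2 fun k => by
      have := (coord_of_mem_curvature_supp_shift r m he).2 k; omega)
    (curvature_supp_shift_not_mem r (by omega)) (supp_union_collar_not_mem r hRm) ha hb hp
    hBad₁ hBad₂ hosc₁ hosc₂ hμ₁ hμ₂
  calc |latticeConnectedCorr r.ρ β (2 * L + 1) r.curvature.F r.curvature.F m|
      ≤ a * b / 4 + 8 * (6 * (r.N : ℝ)) ^ 2 * p := h
    _ ≤ a * b / 4 + 16 * (6 * (r.N : ℝ)) ^ 2 * p := by nlinarith [sq_nonneg (6 * (r.N : ℝ))]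

end Summit.QuantumFields.YangMills.Theorems.TunedSequenceExists.DirichletBoxLocalisation.Decoupling

end
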